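import Mathlib
import HarnessLib
import Summits.HubbardSuperconductivity.HubbardSuperconductivity.Theorems.KLProgrammeKLRegimeEngineTowerRemeasureWtAll

/-!
# Route `KLProgramme` — crux K3 ENGINE (stmt-HubbardSuperconductivity-20437 `KLRegimeEngineV17F2`), stub (b) v2, THE LEVELS PACKAGE (ℓ), instantiation (I2):
# THE WEIGHTED SECOND-CONSERVATION-GAIN (`_abs`) `_flow_all` ROWS WITH AN m-UNIFORM CONSTANT («(I2)-CONST-UNIFORM», weighted track, File D §3–§5; seat p4 g17)

The absolute count is already typed `∃ κ D ∀ m` (`D^{m+1}`) and its thresholds are m-free, so the only per-degree quantity of the `_abs` rows of `…RemeasureWtAll` is the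
outer `∃ C` with `C = (3CJ/2)^{m+1}·D^{m+1}·27^{m+1} = C₀^{m+1}`.  Same proofs with `m, 5 ≤ m` moved inside:

* **`klWtPinnedSumAt_jump_le_klEng_flow_all_abs_uniform (R) (c″)`** — `∃ C₀ > 0, R.WF2 → ∃ c₃′ U₀′, ∀ m ≥ 5, …: ≤ C₀^{m+1}·(2^{J′})^{m−2}·N`;
* **`klWtPinnedSumAt_scaleZero_remeasure_le_klEng_flow_all_abs_uniform`**, **`klWtPinnedSumAt_klTowerIncr_remeasure_le_klEng_flow_all_abs_uniform`** — UV summand and `Δ_0`.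
Compositions of landed theorems; nothing about the model is asserted beyond them; nothing asserts (ℓ), any stub, K3 or superconductivity.
References: BGM 2006 §2.8 (2.76), (2.82)–(2.84) [cite: BenfattoGiulianiMastropietro2006].
-/

noncomputable section

namespace Summit.HubbardSuperconductivity.HubbardSuperconductivity.Theorems.EngineV8

set_option linter.dupNamespace false -- summit = problem name (single-conjunct summit), D-0017

open Classical
open Real Finset Literature.MathematicalPhysics.QuantumLattice Literature.Probability.LatticeModels GrassmannAlgebra
open Literature.Probability.LatticeModels.BattleFederbush
open Literature.MathematicalPhysics.QuantumLattice.FermiRG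
open Summit.HubbardSuperconductivity.HubbardSuperconductivity.Theorems.KLRegimeSplit
open Summit.HubbardSuperconductivity.HubbardSuperconductivity.Theorems.KLProgrammeLegKernels
open Summit.HubbardSuperconductivity.HubbardSuperconductivity.Theorems.DispersionFlow
open Summit.HubbardSuperconductivity.HubbardSuperconductivity.Theorems.KLRegimeWick
open Summit.HubbardSuperconductivity.HubbardSuperconductivity.Theorems.TorusFourierL2
open Summit.HubbardSuperconductivity.HubbardSuperconductivity.Theorems.PerturbedFermiCurve

/-- **THE PER-PAIR RE-MEASURED ROW WITH THE SECOND CONSERVATION GAIN, flow frame, no window — m-UNIFORM** (twin of `klWtPinnedSumAt_jump_le_klEng_flow_all_abs`;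
`C₀ = (3CJ/2)·27·D`). [cite: BenfattoGiulianiMastropietro2006, §2.8 (2.76), (2.82)-(2.84)] -/
theorem klWtPinnedSumAt_jump_le_klEng_flow_all_abs_uniform (R : RenConsts) (c'' : ℝ) (hc'' : 0 ≤ c'') :
    ∃ C₀ : ℝ, 0 < C₀ ∧ (R.WF2 → ∃ c₃' : ℝ, 0 < c₃' ∧ ∃ U₀' : ℝ, 0 < U₀' ∧ ∀ m : ℕ, 5 ≤ m →
      ∀ (G : GeoConsts) (P : SplitConsts) (Q : EngConsts) (cc : ℝ), 0 < cc → cc ≤ klEngC₃6 P R → cc ≤ c₃' →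
      ∀ μ ∈ klWindowC, ∀ U : ℝ, 0 < U → U ≤ min (klEngU₀3 P R cc) (1 / (R.Gfr 3 + 1)) → U ≤ U₀' → c'' * U ≤ 1 →
      ∀ β : ℝ, klBetaMin ≤ β → β ≤ Real.exp (cc / U ^ 2) →
      ∀ (L M : ℕ) [NeZero L] [NeZero M], klEngL₃ β U ≤ L → klEngM₃ β U L ≤ M →
      ∀ n : ℕ, 1 ≤ n → n ≤ nScales β + 1 → IsKLRegime U cc (-(n : ℤ)) → HistP klPredsV17F2 L M G P Q R β U μ 0 n →
        (∀ m', 1 ≤ m' → m' < n → FlowPieceOscAt L M c'' β U μ m') →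
        ∀ k J' : ℕ, k + 1 ≤ J' → J' ≤ n →
        ∀ T : HubbardGrassmann L M,
          (∀ (m' : ℕ) (X : Fin m' → HubbardFieldIdx L M), ∑ i, signedMomentum L (X i).2 (X i).1.1.2 ≠ 0 → kernel ℂ T m' X = 0) →
        ∀ j : ℕ, J' ≤ j → ∀ (q : Fin (m + 1)) (w : SpaceTimeIdx L M × SectorLeg (sectorCount J')) (N : ℝ), 0 ≤ N →
          (∀ w' : SpaceTimeIdx L M × SectorLeg (sectorCount k),
            klWtPinnedSumAt L M β μ (klFlowFrameU L M β U μ n) k j (m + 1) T q w' ≤ N) →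
          klWtPinnedSumAt L M β μ (klFlowFrameU L M β U μ n) J' j (m + 1) T q w ≤ C₀ ^ (m + 1) * ((2 : ℝ) ^ J') ^ (m - 2) * N) := by
  obtain ⟨CJ, hCJ, hov⟩ := overlapWt_jump_sums_klEng_flow_all R c'' hc''
  obtain ⟨D, hD, hreg⟩ := klWtPinnedSumAt_jump_le_of_overlap_abs
  refine ⟨3 * CJ / 2 * (D * 27), by positivity, fun hR2 => ?_⟩
  have hRj : ∀ j, 0 ≤ R.Gfr j := gfr_nonneg_of_wf2 hR2
  obtain ⟨c₃, hc₃, U₀, hU₀, hjump⟩ := hreg R hRj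
  refine ⟨c₃, hc₃, U₀, hU₀, ?_⟩
  intro m hm G P Q cc hcc hcc6 hcc₃' μ hμ U hU hUle hU₀' hcU β hβmin hβc L M _ _ hL3 hM3 n hn1 hnN hkl hhist hosc k J' hJ hJn T hT j hjJ q w N hN0 hN
  have hβ : 0 < β := KLRegimeSplit.pos_of_klBetaMin_le hβmin
  set K : TrigPolyC4v := klFlowFrameU L M β U μ n with hK
  have hfr : FrameOK R U (nScales β) μ K := frameOK_klFlowFrameU_of_histP_le hR2 hn1 le_rfl hnN hhist
  obtain ⟨_, hcolJ, hrowJ⟩ := hov G P Q cc hR2 hcc hcc6 μ hμ U hU hUle hcU β hβmin hβc L M hL3 hM3 n hn1 hnN hkl hhist hosc k J' hJ hJn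
  have hc₁0 : (0 : ℝ) ≤ 3 * CJ * M / β := by positivity
  have hcol₁ : ∀ (ω'' : Fin (sectorCount J')) (ω' : Fin (sectorCount k)) (σ c : Fin 2) (x' : SpaceTimeIdx L M),
      ∑ x'' : SpaceTimeIdx L M, ‖(sectorAnalysisMatrix L M β (klAnisoFamily L M β μ K klE0 J') *
        sectorSubMatrix L M β (bgmFatMultiplier L M klE0 β (nambuXiCT L μ K) k)) (x'', ((ω'', σ), c)) (x', ((ω', σ), c))‖ *
          klScaleWt L M β j
            {latticeLegPos (2 * (2 * M)) ((x'', ((ω'', σ), c)) : SpaceTimeIdx L M × SectorLeg (sectorCount J')),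
              latticeLegPos (2 * (2 * M)) ((x', ((ω', σ), c)) : SpaceTimeIdx L M × SectorLeg (sectorCount k))} ≤ 3 * CJ * M / β := by
    intro ω'' ω' σ c x'
    refine le_trans (sum_le_sum fun x'' _ => mul_le_mul_of_nonneg_left (klScaleWt_le_of_le β hjJ _) (norm_nonneg _)) ?_
    exact hcolJ ω'' ω' σ c x'
  have hrow₁ : ∀ (ω'' : Fin (sectorCount J')) (ω' : Fin (sectorCount k)) (σ c : Fin 2) (x'' : SpaceTimeIdx L M),
      ∑ x' : SpaceTimeIdx L M, ‖(sectorAnalysisMatrix L M β (klAnisoFamily L M β μ K klE0 J') *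
        sectorSubMatrix L M β (bgmFatMultiplier L M klE0 β (nambuXiCT L μ K) k)) (x'', ((ω'', σ), c)) (x', ((ω', σ), c))‖ *
          klScaleWt L M β j
            {latticeLegPos (2 * (2 * M)) ((x'', ((ω'', σ), c)) : SpaceTimeIdx L M × SectorLeg (sectorCount J')),
              latticeLegPos (2 * (2 * M)) ((x', ((ω', σ), c)) : SpaceTimeIdx L M × SectorLeg (sectorCount k))} ≤ 3 * CJ * M / β := by
    intro ω'' ω' σ c x''
    refine le_trans (sum_le_sum fun x' _ => mul_le_mul_of_nonneg_left (klScaleWt_le_of_le β hjJ _) (norm_nonneg _)) ?_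
    exact hrowJ ω'' ω' σ c x''
  have h := hjump cc hcc hcc₃' U hU hU₀' β hβmin hβc μ hμ μ K hfr L M k J' hJ T hT j _ _ hc₁0 hc₁0 hcol₁ hrow₁ m hm q w N hN0 hN
  have hMne : (M : ℝ) ≠ 0 := by exact_mod_cast NeZero.ne M
  have hεc : imagTimeWeight β M * (3 * CJ * M / β) = 3 * CJ / 2 := by
    unfold imagTimeWeight; field_simp
  have hconst : (3 * CJ * M / β) ^ m * (3 * CJ * M / β) * imagTimeWeight β M ^ (m + 1) = (3 * CJ / 2) ^ (m + 1) := by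
    rw [← pow_succ, ← mul_pow, mul_comm (3 * CJ * M / β), hεc]
  calc klWtPinnedSumAt L M β μ K J' j (m + 1) T q w
      ≤ (3 * CJ * M / β) ^ m * (3 * CJ * M / β) * imagTimeWeight β M ^ (m + 1) * (D ^ (m + 1) * 27 ^ (m + 1)) *
          ((2 : ℝ) ^ J') ^ (m - 2) * N := h
    _ = (3 * CJ / 2 * (D * 27)) ^ (m + 1) * ((2 : ℝ) ^ J') ^ (m - 2) * N := by rw [hconst, mul_pow, mul_pow]

/-- **THE UV SUMMAND RE-MEASURED WITH THE SECOND CONSERVATION GAIN, flow frame, no window — m-UNIFORM** (twin of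
`klWtPinnedSumAt_scaleZero_remeasure_le_klEng_flow_all_abs`). [cite: BenfattoGiulianiMastropietro2006, §2.8 (2.76), (2.82)-(2.84)] -/
theorem klWtPinnedSumAt_scaleZero_remeasure_le_klEng_flow_all_abs_uniform (R : RenConsts) (c'' : ℝ) (hc'' : 0 ≤ c'') :
    ∃ C₀ : ℝ, 0 < C₀ ∧ (R.WF2 → ∃ c₃' : ℝ, 0 < c₃' ∧ ∃ U₀' : ℝ, 0 < U₀' ∧ ∀ m : ℕ, 5 ≤ m →
      ∀ (G : GeoConsts) (P : SplitConsts) (Q : EngConsts) (cc : ℝ), 0 < cc → cc ≤ klEngC₃6 P R → cc ≤ c₃' →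
      ∀ μ ∈ klWindowC, ∀ U : ℝ, 0 < U → U ≤ min (klEngU₀3 P R cc) (1 / (R.Gfr 3 + 1)) → U ≤ U₀' → c'' * U ≤ 1 →
      ∀ β : ℝ, klBetaMin ≤ β → β ≤ Real.exp (cc / U ^ 2) →
      ∀ (L M : ℕ) [NeZero L] [NeZero M], klEngL₃ β U ≤ L → klEngM₃ β U L ≤ M →
      ∀ n : ℕ, 1 ≤ n → n ≤ nScales β + 1 → IsKLRegime U cc (-(n : ℤ)) → HistP klPredsV17F2 L M G P Q R β U μ 0 n →
        (∀ m', 1 ≤ m' → m' < n → FlowPieceOscAt L M c'' β U μ m') →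
        ∀ J' : ℕ, 1 ≤ J' → J' ≤ n →
        ∀ j : ℕ, J' ≤ j → ∀ (q : Fin (m + 1)) (w : SpaceTimeIdx L M × SectorLeg (sectorCount J')) (N₀ : ℝ), 0 ≤ N₀ →
          (∀ w' : SpaceTimeIdx L M × SectorLeg (sectorCount 0),
            klWtPinnedSum L M β U μ (klFlowFrameU L M β U μ n) 0 (m + 1) q w' ≤ N₀) →
          klWtPinnedSumAt L M β μ (klFlowFrameU L M β U μ n) J' j (m + 1)
              (klEffectiveAction L M β U μ (klFlowFrameU L M β U μ n) klE0 0) q w ≤ C₀ ^ (m + 1) * ((2 : ℝ) ^ J') ^ (m - 2) * N₀) := by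
  obtain ⟨C, hC, h⟩ := klWtPinnedSumAt_jump_le_klEng_flow_all_abs_uniform R c'' hc''
  refine ⟨C, hC, fun hR2 => ?_⟩
  obtain ⟨c₃, hc₃, U₀, hU₀, h'⟩ := h hR2
  refine ⟨c₃, hc₃, U₀, hU₀, ?_⟩
  intro m hm G P Q cc hcc hcc6 hcc₃' μ hμ U hU hUle hU₀' hcU β hβmin hβc L M _ _ hL3 hM3 n hn1 hnN hkl hhist hosc J' hJ1 hJn j hjJ q w N₀ hN0 hN
  have hβ : 0 < β := KLRegimeSplit.pos_of_klBetaMin_le hβmin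
  set K : TrigPolyC4v := klFlowFrameU L M β U μ n with hK
  refine h' m hm G P Q cc hcc hcc6 hcc₃' μ hμ U hU hUle hU₀' hcU β hβmin hβc L M hL3 hM3 n hn1 hnN hkl hhist hosc 0 J' (by omega) hJn
    (klEffectiveAction L M β U μ K klE0 0) (klEffectiveAction_momentumConserving β U μ K klE0 0) j hjJ q w N₀ hN0 fun w' => ?_
  calc klWtPinnedSumAt L M β μ K 0 j (m + 1) (klEffectiveAction L M β U μ K klE0 0) q w'
      ≤ klWtPinnedSumOf L M β μ K 0 (m + 1) (klEffectiveAction L M β U μ K klE0 0) q w' :=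
        klWtPinnedSumAt_le_klWtPinnedSumOf hβ.le μ K (Nat.zero_le j) (m + 1) _ q w'
    _ = klWtPinnedSum L M β U μ K 0 (m + 1) q w' := klWtPinnedSumOf_klEffectiveAction β U μ K 0 (m + 1) q w'
    _ ≤ N₀ := hN w'

/-- **`Δ_0` RE-MEASURED WITH THE SECOND CONSERVATION GAIN, flow frame, no window — m-UNIFORM** (twin of
`klWtPinnedSumAt_klTowerIncr_remeasure_le_klEng_flow_all_abs`). [cite: BenfattoGiulianiMastropietro2006, §2.8 (2.76), (2.82)-(2.84)] -/
theorem klWtPinnedSumAt_klTowerIncr_remeasure_le_klEng_flow_all_abs_uniform (R : RenConsts) (c'' : ℝ) (hc'' : 0 ≤ c'') :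
    ∃ C₀ : ℝ, 0 < C₀ ∧ (R.WF2 → ∃ c₃' : ℝ, 0 < c₃' ∧ ∃ U₀' : ℝ, 0 < U₀' ∧ ∀ m : ℕ, 5 ≤ m →
      ∀ (G : GeoConsts) (P : SplitConsts) (Q : EngConsts) (cc : ℝ), 0 < cc → cc ≤ klEngC₃6 P R → cc ≤ c₃' →
      ∀ μ ∈ klWindowC, ∀ U : ℝ, 0 < U → U ≤ min (klEngU₀3 P R cc) (1 / (R.Gfr 3 + 1)) → U ≤ U₀' → c'' * U ≤ 1 →
      ∀ β : ℝ, klBetaMin ≤ β → β ≤ Real.exp (cc / U ^ 2) →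
      ∀ (L M : ℕ) [NeZero L] [NeZero M], klEngL₃ β U ≤ L → klEngM₃ β U L ≤ M →
      ∀ n : ℕ, 1 ≤ n → n ≤ nScales β + 1 → IsKLRegime U cc (-(n : ℤ)) → HistP klPredsV17F2 L M G P Q R β U μ 0 n →
        (∀ m', 1 ≤ m' → m' < n → FlowPieceOscAt L M c'' β U μ m') →
        ∀ d k k' : ℕ, 2 ≤ d → k' < k → d * k - 1 ≤ n →
        ∀ j : ℕ, d * k - 1 ≤ j → ∀ (q : Fin (m + 1)) (w : SpaceTimeIdx L M × SectorLeg (sectorCount (d * k - 1))),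
          klWtPinnedSumAt L M β μ (klFlowFrameU L M β U μ n) (d * k - 1) j (m + 1)
              (klTowerIncr L M β U μ (klFlowFrameU L M β U μ n) d k') q w ≤
            C₀ ^ (m + 1) * ((2 : ℝ) ^ (d * k - 1)) ^ (m - 2) * klTowerBornWtAt L M β U μ (klFlowFrameU L M β U μ n) d k' j (m + 1)) := by
  obtain ⟨C, hC, h⟩ := klWtPinnedSumAt_jump_le_klEng_flow_all_abs_uniform R c'' hc''
  refine ⟨C, hC, fun hR2 => ?_⟩
  obtain ⟨c₃, hc₃, U₀, hU₀, h'⟩ := h hR2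
  refine ⟨c₃, hc₃, U₀, hU₀, ?_⟩
  intro m hm G P Q cc hcc hcc6 hcc₃' μ hμ U hU hUle hU₀' hcU β hβmin hβc L M _ _ hL3 hM3 n hn1 hnN hkl hhist hosc d k k' hd hk hkn j hj q w
  have hβ : 0 < β := KLRegimeSplit.pos_of_klBetaMin_le hβmin
  exact h' m hm G P Q cc hcc hcc6 hcc₃' μ hμ U hU hUle hU₀' hcU β hβmin hβc L M hL3 hM3 n hn1 hnN hkl hhist hosc (d * k') (d * k - 1) (block_jump_le hd hk) hkn
    (klTowerIncr L M β U μ _ d k') (fun m' X hX => klTowerIncr_momentumConserving β U μ _ d k' m' X hX) j hj q w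
    (klTowerBornWtAt L M β U μ _ d k' j (m + 1)) (klTowerBornWtAt_nonneg hβ.le U μ _ d k' j (m + 1))
    (fun w' => klWtPinnedSumAt_le_klTowerBornWtAt β U μ _ d k' j (m + 1) q w')

end Summit.HubbardSuperconductivity.HubbardSuperconductivity.Theorems.EngineV8

end
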